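import Mathlib

/-!
# Route LiouvilleSarnak — crux `LiouvilleCutRank` (stmt-ValiantsHypothesis-14775): soundness of the
# PACKED certificate check for the rung `W = 64`

For `W = 64` (window length `K = 12`) a term-by-term kernel check of `S · C ≡ 1 (mod p)` costs `64³`
elementary reductions per word (≈ 40 s); the certificate files
`Theorems/LiouvilleSarnakCutRankSixtyFourCert<i>.lean` therefore let the kernel do the inner sums with
BIG-NUMBER arithmetic: row `k` of `C` (base-`p` digits `d(k,b) = C / p^(64k+b) mod p`) is packed as
`cp_k = Σ_b d(k,b) · 2^(14 b)`, and for each row `a` of the sign matrix (`s(a,k) ∈ {1, p-1}` from the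
sign table `B`) the single number `v_a = Σ_k s(a,k) · cp_k` carries ALL the dot products
`D(a,b) = Σ_k s(a,k) d(k,b) < 2^14` as its base-`2^14` digits; the check reads them off as
`(v_a >>> 14 b) mod 2^14` and compares `mod p` with `[a = b]`.  This file proves that reading:

* §1 `digit_of_sum` — `(Σ_{b<n} D(b) β^b) / β^j mod β = D(j)` when all `D(b) < β`; list/`Finset`
  bookkeeping (`sum_range_list`);
* §2 `chunk_sound` — generic in the table `T`, the word interval `[lo, hi)` and the certificate list
  `L` of entries `(m, p, X, Y, B, C)`: if the closed Boolean of a certificate chunk evaluates to `true`,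
  every `m < 2048` in `[lo, hi)` with exactly six set bits among bits `0 … 11` admits `p > 1` and data
  `X, Y, C` with `Σ_{k<64} S(a,k) C(k,b) ≡ [a = b] (mod p)` for all `a, b : Fin 64`
  (`S(a,k) ∈ {1, p-1}` encoding `λ(N(a,k)+1) = ±1` read off `T` at
  `N(a,k) = Σ_q 2^q (bit q of m ? X_{12a+q} : Y_{12k+q})`) — the hypothesis shape of
  `LiouvilleSarnakCutRankModCert.det_ne_zero_of_mod_cert`.

Honest framing: bookkeeping for a finite rung of an OPEN crux; nothing here bears on VP versus VNP.
No definitions.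
-/

-- the directory `ValiantsHypothesis/ValiantsHypothesis` repeats the summit name (tree layout)
set_option linter.dupNamespace false

namespace Summit.ValiantsHypothesis.ValiantsHypothesis.Theorems.LiouvilleSarnakCutRankSixtyFourSound

/-! ### §1 Digits of a packed sum -/

/-- `((List.range n).map f).sum = Σ_{b < n} f b`. [folklore] -/
theorem sum_range_list {M : Type*} [AddCommMonoid M] (f : ℕ → M) (n : ℕ) :
    ((List.range n).map f).sum = ∑ b ∈ Finset.range n, f b := by
  induction n with
  | zero => simp
  | succ n ih =>
    rw [List.range_succ, List.map_append, List.sum_append, ih, Finset.sum_range_succ]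
    simp

/-- **Digit extraction.**  If `D b < β` for all `b < n` and `j < n`, then digit `j` of
`Σ_{b<n} D(b) β^b` in base `β` is `D(j)`: `(Σ_{b<n} D b β^b) / β^j % β = D j`. [folklore] -/
theorem digit_of_sum (β : ℕ) (hβ : 0 < β) :
    ∀ (j n : ℕ) (D : ℕ → ℕ), (∀ b < n, D b < β) → j < n →
      (∑ b ∈ Finset.range n, D b * β ^ b) / β ^ j % β = D j := by
  intro j
  induction j with
  | zero =>
    intro n D hD hj
    obtain ⟨n', rfl⟩ : ∃ n', n = n' + 1 := ⟨n - 1, by omega⟩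
    rw [Finset.sum_range_succ', pow_zero, Nat.div_one, mul_one]
    have hfac : ∑ b ∈ Finset.range n', D (b + 1) * β ^ (b + 1) =
        β * ∑ b ∈ Finset.range n', D (b + 1) * β ^ b := by
      rw [Finset.mul_sum]
      exact Finset.sum_congr rfl fun b _ => by ring
    rw [hfac, Nat.mul_add_mod]
    exact Nat.mod_eq_of_lt (hD 0 hj)
  | succ j ih =>
    intro n D hD hj
    obtain ⟨n', rfl⟩ : ∃ n', n = n' + 1 := ⟨n - 1, by omega⟩
    rw [Finset.sum_range_succ', pow_zero, mul_one]
    have hfac : ∑ b ∈ Finset.range n', D (b + 1) * β ^ (b + 1) =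
        β * ∑ b ∈ Finset.range n', D (b + 1) * β ^ b := by
      rw [Finset.mul_sum]
      exact Finset.sum_congr rfl fun b _ => by ring
    rw [hfac, pow_succ', ← Nat.div_div_eq_div_mul, Nat.mul_add_div hβ,
      Nat.div_eq_of_lt (hD 0 (by omega)), add_zero]
    exact ih n' (fun b => D (b + 1)) (fun b hb => hD (b + 1) (by omega)) (by omega)

/-! ### §2 Soundness of a packed certificate chunk -/

/-- **Soundness of a packed chunk check** (generic in the table `T`, the word interval `[lo, hi)` and
the certificate list `L`; see the module docstring for the encoding).  [folklore] -/
theorem chunk_sound (T lo hi : ℕ) (L : List (ℕ × ℕ × ℕ × ℕ × ℕ × ℕ))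
    (h : (fun (T lo hi : ℕ) (L : List (ℕ × ℕ × ℕ × ℕ × ℕ × ℕ)) =>
      (List.range 2048).all fun m =>
        !(Nat.count (fun k => Nat.testBit m k = true) 12 == 6 && lo ≤ m && m < hi) ||
          L.any fun e => e.1 == m && decide (1 < e.2.1) && decide (e.2.1 ≤ 13) &&
            ((List.finRange 64).all fun a => (List.finRange 64).all fun k =>
              Nat.testBit e.2.2.2.2.1 (64 * (a : ℕ) + k) ==
                Nat.testBit T (Nat.ofBits fun q : Fin 12 =>
                  if Nat.testBit m q then Nat.testBit e.2.2.1 (12 * (a : ℕ) + q)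
                  else Nat.testBit e.2.2.2.1 (12 * (k : ℕ) + q))) &&
            ((List.range 64).all fun a =>
              (fun v : ℕ => (List.range 64).all fun b =>
                  (v >>> (14 * b)) % 16384 % e.2.1 == (if a = b then 1 else 0))
                (((List.range 64).map fun k =>
                  (if Nat.testBit e.2.2.2.2.1 (64 * a + k) then 1 else e.2.1 - 1) *
                    ((List.range 64).map fun b =>
                      (e.2.2.2.2.2 / e.2.1 ^ (64 * k + b) % e.2.1) <<< (14 * b)).sum).sum)))
      T lo hi L = true) :
    ∀ m < 2048, Nat.count (fun k => Nat.testBit m k = true) 12 = 6 → lo ≤ m → m < hi →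
      ∃ p X Y C : ℕ, 1 < p ∧ ∀ a b : Fin 64,
        (∑ k : Fin 64,
          (if Nat.testBit T (Nat.ofBits fun q : Fin 12 =>
                if Nat.testBit m q then Nat.testBit X (12 * (a : ℕ) + q)
                else Nat.testBit Y (12 * (k : ℕ) + q))
            then 1 else p - 1) * (C / p ^ (64 * (k : ℕ) + b) % p)) % p =
        if a = b then 1 else 0 := by
  simp only [List.all_eq_true, List.mem_range, Bool.or_eq_true, Bool.not_eq_true',
    Bool.and_eq_false_iff, List.any_eq_true, Bool.and_eq_true, List.mem_finRange,
    true_implies, beq_iff_eq, decide_eq_true_eq] at h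
  intro m hm hc hlo hhi
  rcases h m hm with hneg | ⟨e, -, ⟨⟨⟨hem, hp⟩, hp13⟩, hB⟩, hV⟩
  · exfalso
    simp only [beq_eq_false_iff_ne, ne_eq, decide_eq_false_iff_not, not_le, not_lt] at hneg
    omega
  subst hem
  refine ⟨e.2.1, e.2.2.1, e.2.2.2.1, e.2.2.2.2.2, hp, fun a b => ?_⟩
  -- abbreviations
  set p : ℕ := e.2.1 with hp_def
  set B : ℕ := e.2.2.2.2.1 with hB_def
  set C : ℕ := e.2.2.2.2.2 with hC_def
  set s : ℕ → ℕ := fun k => if Nat.testBit B (64 * (a : ℕ) + k) then 1 else p - 1 with hs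
  set d : ℕ → ℕ → ℕ := fun k b' => C / p ^ (64 * k + b') % p with hd
  set D : ℕ → ℕ := fun b' => ∑ k ∈ Finset.range 64, s k * d k b' with hD
  -- bounds
  have hs_le : ∀ k, s k ≤ 12 := by
    intro k; simp only [hs]; split_ifs <;> omega
  have hd_le : ∀ k b', d k b' ≤ 12 := by
    intro k b'
    have := Nat.mod_lt (C / p ^ (64 * k + b')) (show 0 < p by omega)
    simp only [hd]; omega
  have hD_lt : ∀ b', D b' < 16384 := by
    intro b'
    calc D b' ≤ ∑ _k ∈ Finset.range 64, 12 * 12 :=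
          Finset.sum_le_sum fun k _ => Nat.mul_le_mul (hs_le k) (hd_le k b')
      _ < 16384 := by simp
  -- the packed number `v_a` and its digits
  have hv : ((List.range 64).map fun k => s k *
        ((List.range 64).map fun b' => d k b' <<< (14 * b')).sum).sum =
      ∑ b' ∈ Finset.range 64, D b' * 16384 ^ b' := by
    rw [sum_range_list]
    simp_rw [sum_range_list, Nat.shiftLeft_eq, Finset.mul_sum]
    rw [Finset.sum_comm]
    refine Finset.sum_congr rfl fun b' _ => ?_
    rw [hD, Finset.sum_mul]
    refine Finset.sum_congr rfl fun k _ => ?_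
    rw [pow_mul]; norm_num; ring
  have hVab := hV (a : ℕ) a.isLt (b : ℕ) b.isLt
  change (((List.range 64).map fun k => s k *
      ((List.range 64).map fun b' => d k b' <<< (14 * b')).sum).sum >>> (14 * (b : ℕ))) %
        16384 % p = if (a : ℕ) = (b : ℕ) then 1 else 0 at hVab
  rw [hv, Nat.shiftRight_eq_div_pow, pow_mul, show (2 : ℕ) ^ 14 = 16384 by norm_num,
    digit_of_sum 16384 (by norm_num) (b : ℕ) 64 D (fun b' _ => hD_lt b') b.isLt] at hVab
  -- the goal's sum is `D b`
  have hgoal : (∑ k : Fin 64,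
      (if Nat.testBit T (Nat.ofBits fun q : Fin 12 =>
            if Nat.testBit e.1 q then Nat.testBit e.2.2.1 (12 * (a : ℕ) + q)
            else Nat.testBit e.2.2.2.1 (12 * (k : ℕ) + q))
        then 1 else p - 1) * (C / p ^ (64 * (k : ℕ) + b) % p)) = D b := by
    simp only [hD]
    rw [← Fin.sum_univ_eq_sum_range (fun k => s k * d k (b : ℕ)) 64]
    refine Finset.sum_congr rfl fun k _ => ?_
    rw [← hB a k]
  rw [hgoal, hVab]
  simp [Fin.ext_iff]

end Summit.ValiantsHypothesis.ValiantsHypothesis.Theorems.LiouvilleSarnakCutRankSixtyFourSound
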